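import Summits.HodgeConjecture.CorCM.SexticOcticWeilPowersHodgeOfMarkman
import Summits.HodgeConjecture.CorCM.OcticCurveFourfoldHodgeOfMarkman
import HarnessLib

/-!
# COR-CM — the Hodge conjecture for `E^a × T^n × B^m` — a `(1,2)`-threefold `T` over a SEXTIC CM field `K₁ ∋ k`, a `(1,3)`-fourfold `B` over
# an OCTIC CM field `K₂ ∋ k`, the CM curve `E` of `k` — INTRINSIC form, modulo Markman's fourfold and hyperbolic-sixfold theorems

Cell `pub-hodgecm2` (COR-CM), seat b30 gen 26 (2026-08-23); count-neutral own lane SEXTIC-OCTIC; sequel of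
`CorCM/SexticOcticWeilPowersHodgeOfMarkman.lean` (frame form).  Theorems only; no definition, no named fact, no `sorry`.  HONEST FRAMING: a
CONDITIONAL result for a NAMED class of CM abelian varieties — `HC_CM` is NOT proved and is not mentioned; displayed deep inputs = the two
Markman facts only.

* §1 `card_filter_comp_eq_of_finrank` (the `τ`-fibre of `Hom(K, ℂ)` has `n` elements when `[K:ℚ] = 2n`, `[k:ℚ] = 2`), **`exists_frame_fin`**
  (a frame `Hom(K,ℂ) ≃ Fin (n+1) × Bool` recording signs and conjugation and reading a type with ONE member over `τ` as «positive exactly at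
  position `0`» — the size-free form of gen 18's `OcticCurveFourfold.exists_frame`);
* §2 **`hodgeConjectureFor_biproduct_comp_vec_of_markman`** — `k` imaginary quadratic, `K₁ ⊇ i₁(k)` ANY sextic CM field, `K₂ ⊇ i₂(k)` ANY
  octic CM field, `E ⊨ (k;Ψ)`, `T ⊨ (K₁;Φ₁)` with `#{s ∈ Φ₁ | s ∘ i₁ = τ} = 1` (`k`-signature `(1,2)`), `B ⊨ (K₂;Φ₂)` with
  `#{t ∈ Φ₂ | t ∘ i₂ = τ} = 1` (`k`-signature `(1,3)`), `τ ∈ Ψ`, and JOINT TRANSITIVITY `hJT` of `Aut(ℂ)` on the pairs of embeddings over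
  `τ` (automatic: the sequel `…JointTransitive`): for EVERY `κ : Fin N → Fin 3`, `HodgeConjectureFor (⨁_j ![E, T, B] (κ j))` — all
  `E^a × T^n × B^m`, any order — GIVEN ONLY the two Markman facts; `…_of_avDominatedBy_…` (everything dominated).
[cite: Markman2025SurveySecant, Thm. 1.2] [cite: Markman2025SecantWeil, Thm 1.5.1] [cite: Pohlmann1968, Thm 1] [cite: Shimura1998, §18.2 Lemma (i)]
[cite: MumfordAV1970, §19]

## References
* [Markman2025SurveySecant] E. Markman, arXiv:2509.23403, Thm. 1.2.  [Markman2025SecantWeil] E. Markman, arXiv:2502.03415, Thm. 1.5.1.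
  [Pohlmann1968] H. Pohlmann, Ann. of Math. 88 (1968), Thm 1.  [Shimura1998] G. Shimura, *Abelian Varieties with CM and Modular Functions*,
  §18.2 Lemma (i).  [MumfordAV1970] D. Mumford, *Abelian Varieties*, §19.
-/

noncomputable section

open CategoryTheory CategoryTheory.Limits NumberField

namespace Summit.HodgeConjecture.CorCM.SexticOcticWeil

open Literature.AlgebraicGeometry Literature.AlgebraicGeometry.Motives Literature.AlgebraicGeometry.HodgeTheory
open Literature.AlgebraicGeometry.ComplexMultiplication (IsCMTypeRealisation)
open Literature.AlgebraicTopology.SingularHomology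

open scoped Classical

/-! ## §1 Counting in the `τ`-fibre; frames of any size -/

section Frame

variable {K : Type} [Field K] [NumberField K] {k : Type} [Field k] [NumberField k]

/-- **Each complex embedding of `k` has exactly `n` extensions to `K`** along `i : k → K`, `[k:ℚ] = 2`, `[K:ℚ] = 2n` (the `k`-algebra maps
`K →ₐ[k] ℂ`, `[K:k] = n` of them: Mathlib `AlgHom.card`, tower law; the size-free form of gen 18's
`OcticCurveFourfold.card_filter_comp_eq_four`). [folklore] -/
theorem card_filter_comp_eq_of_finrank {n : ℕ} (i : k →+* K) (hK : Module.finrank ℚ K = 2 * n) (h2 : Module.finrank ℚ k = 2)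
    (τ : k →+* ℂ) : (Finset.univ.filter fun s : K →+* ℂ => s.comp i = τ).card = n := by
  letI : Algebra k K := i.toAlgebra
  letI : Algebra k ℂ := τ.toAlgebra
  haveI : IsScalarTower ℚ k K := IsScalarTower.of_algebraMap_eq fun q => by
    rw [RingHom.algebraMap_toAlgebra, eq_ratCast, eq_ratCast, map_ratCast]
  haveI : FiniteDimensional k K := FiniteDimensional.right ℚ k K
  have hkK : Module.finrank k K = n := by
    have h := Module.finrank_mul_finrank ℚ k K
    rw [h2, hK] at h
    omega
  have hcomm : ∀ f : K →ₐ[k] ℂ, f.toRingHom.comp i = τ := fun f => RingHom.ext fun x => f.commutes x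
  have hcomm' : ∀ s : {s : K →+* ℂ // s.comp i = τ}, ∀ x : k, s.1.toFun (algebraMap k K x) = algebraMap k ℂ x :=
    fun s x => RingHom.congr_fun s.2 x
  let eqv : (K →ₐ[k] ℂ) ≃ {s : K →+* ℂ // s.comp i = τ} :=
    { toFun := fun f => ⟨f.toRingHom, hcomm f⟩
      invFun := fun s => ⟨s.1, hcomm' s⟩
      left_inv := fun f => AlgHom.ext fun x => rfl
      right_inv := fun s => Subtype.ext (RingHom.ext fun x => rfl) }
  rw [← Fintype.card_subtype, ← Fintype.card_congr eqv, AlgHom.card, hkK]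

omit [NumberField k] in
/-- **A FRAME of `Hom(K, ℂ)` reading a type with one member over `τ`.**  If the `τ`-fibre has `n + 1` elements and `Φ` has exactly ONE
member over `τ`, there is `e : Hom(K,ℂ) ≃ Fin (n+1) × Bool` with `(e s).2 = [s ∘ i = τ]`, `e s̄ = ((e s).1, ¬(e s).2)`, and
`s ∈ Φ ⟺ (e s).2 = [(e s).1 = 0]` (the member over `τ` at position `0`; over `τ̄` the type is the complement).
[cite: Shimura1998, §18.2 Lemma (i)] -/
theorem exists_frame_fin [IsCMField K] {n : ℕ} (i : k →+* K) {τ : k →+* ℂ} (hττ : ComplexEmbedding.conjugate τ ≠ τ)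
    (hk : ∀ σ : k →+* ℂ, σ = τ ∨ σ = ComplexEmbedding.conjugate τ)
    (hn : (Finset.univ.filter fun s : K →+* ℂ => s.comp i = τ).card = n + 1)
    (Φ : CMType K) (h1 : (Finset.univ.filter fun s : K →+* ℂ => s.comp i = τ ∧ s ∈ Φ.1).card = 1) :
    ∃ e : (K →+* ℂ) ≃ Fin (n + 1) × Bool, (∀ s, (e s).2 = true ↔ s.comp i = τ) ∧
      (∀ s, e (ComplexEmbedding.conjugate s) = ((e s).1, !(e s).2)) ∧ ∀ s, s ∈ Φ.1 ↔ (e s).2 = decide ((e s).1 = 0) := by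
  -- the member `sP` of `Φ` over `τ`
  obtain ⟨sP, hsP⟩ := Finset.card_eq_one.1 h1
  have hsPmem : sP.comp i = τ ∧ sP ∈ Φ.1 := by
    have h : sP ∈ Finset.univ.filter fun s : K →+* ℂ => s.comp i = τ ∧ s ∈ Φ.1 := by rw [hsP]; simp
    exact (Finset.mem_filter.1 h).2
  have huniq : ∀ s : K →+* ℂ, s.comp i = τ → (s ∈ Φ.1 ↔ s = sP) := by
    intro s hs
    constructor
    · intro hΦ
      have h : s ∈ Finset.univ.filter fun s : K →+* ℂ => s.comp i = τ ∧ s ∈ Φ.1 := Finset.mem_filter.2 ⟨by simp, hs, hΦ⟩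
      rw [hsP] at h
      exact Finset.mem_singleton.1 h
    · rintro rfl; exact hsPmem.2
  -- the embeddings over `τ`, numbered with `sP ↦ 0`
  set F : Finset (K →+* ℂ) := Finset.univ.filter fun s : K →+* ℂ => s.comp i = τ with hFdef
  let f : {s // s ∈ F} ≃ Fin (n + 1) := F.equivFinOfCardEq hn
  have hsPF : sP ∈ F := Finset.mem_filter.2 ⟨Finset.mem_univ _, hsPmem.1⟩
  let g : {s // s ∈ F} ≃ Fin (n + 1) := f.trans (Equiv.swap (f ⟨sP, hsPF⟩) 0)
  have hgP : g ⟨sP, hsPF⟩ = 0 := by simp [g]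
  have hmemF : ∀ s : K →+* ℂ, s ∈ F ↔ s.comp i = τ := fun s => by simp [hFdef]
  have hcc : ∀ s : K →+* ℂ, ComplexEmbedding.conjugate (ComplexEmbedding.conjugate s) = s := ComplexEmbedding.involutive_conjugate K
  have hconjcomp : ∀ s : K →+* ℂ, (ComplexEmbedding.conjugate s).comp i = ComplexEmbedding.conjugate (s.comp i) :=
    fun s => RingHom.ext fun _ => rfl
  -- over `τ̄` the conjugate lies over `τ`
  have hconj_over : ∀ s : K →+* ℂ, ¬ s.comp i = τ → (ComplexEmbedding.conjugate s).comp i = τ := by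
    intro s hs
    rw [hconjcomp, (hk (s.comp i)).resolve_left hs, ComplexEmbedding.involutive_conjugate]
  have hconj_over' : ∀ s : K →+* ℂ, s.comp i = τ → ¬ (ComplexEmbedding.conjugate s).comp i = τ := by
    intro s hs h
    rw [hconjcomp, hs] at h
    exact hττ h
  -- the enumeration
  let toF : (K →+* ℂ) → Fin (n + 1) × Bool := fun s =>
    if h : s.comp i = τ then (g ⟨s, (hmemF s).2 h⟩, true)
    else (g ⟨ComplexEmbedding.conjugate s, (hmemF _).2 (hconj_over s h)⟩, false)
  let ofF : Fin (n + 1) × Bool → (K →+* ℂ) := fun p => if p.2 then (g.symm p.1).1 else ComplexEmbedding.conjugate (g.symm p.1).1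
  have hgF : ∀ a : Fin (n + 1), ((g.symm a).1).comp i = τ := fun a => (hmemF _).1 (g.symm a).2
  have hgcongr : ∀ (s t : K →+* ℂ) (hs : s ∈ F) (ht : t ∈ F), s = t → g ⟨s, hs⟩ = g ⟨t, ht⟩ := by
    rintro s t hs ht rfl; rfl
  have htoF_pos : ∀ s (h : s.comp i = τ), toF s = (g ⟨s, (hmemF s).2 h⟩, true) := fun s h => dif_pos h
  have htoF_neg : ∀ s (h : ¬ s.comp i = τ),
      toF s = (g ⟨ComplexEmbedding.conjugate s, (hmemF _).2 (hconj_over s h)⟩, false) := fun s h => dif_neg h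
  have htoF_of : ∀ p, toF (ofF p) = p := by
    rintro ⟨a, b⟩
    cases b
    · have hof : ofF (a, false) = ComplexEmbedding.conjugate (g.symm a).1 := rfl
      have h : ¬ (ComplexEmbedding.conjugate (g.symm a).1).comp i = τ := hconj_over' _ (hgF a)
      rw [hof, htoF_neg _ h, Prod.mk.injEq]
      refine ⟨?_, rfl⟩
      rw [hgcongr _ _ _ (g.symm a).2 (hcc _), Subtype.coe_eta, Equiv.apply_symm_apply]
    · have hof : ofF (a, true) = (g.symm a).1 := rfl
      rw [hof, htoF_pos _ (hgF a), Prod.mk.injEq]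
      exact ⟨by rw [Subtype.coe_eta, Equiv.apply_symm_apply], rfl⟩
  have hof_toF : ∀ s, ofF (toF s) = s := by
    intro s
    by_cases h : s.comp i = τ
    · rw [htoF_pos s h]
      change (g.symm (g ⟨s, _⟩)).1 = s
      rw [Equiv.symm_apply_apply]
    · rw [htoF_neg s h]
      change ComplexEmbedding.conjugate (g.symm (g ⟨ComplexEmbedding.conjugate s, _⟩)).1 = s
      rw [Equiv.symm_apply_apply]
      exact hcc s
  let e : (K →+* ℂ) ≃ Fin (n + 1) × Bool := ⟨toF, ofF, hof_toF, htoF_of⟩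
  have he : ∀ s, e s = toF s := fun _ => rfl
  refine ⟨e, fun s => ?_, fun s => ?_, fun s => ?_⟩
  · -- signs
    rw [he]
    by_cases h : s.comp i = τ
    · rw [htoF_pos s h]; exact ⟨fun _ => h, fun _ => rfl⟩
    · rw [htoF_neg s h]; exact ⟨fun h' => absurd h' Bool.false_ne_true, fun h' => absurd h' h⟩
  · -- conjugation
    rw [he, he]
    by_cases h : s.comp i = τ
    · have h' : ¬ (ComplexEmbedding.conjugate s).comp i = τ := hconj_over' s h
      rw [htoF_pos s h, htoF_neg _ h', Prod.mk.injEq]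
      exact ⟨hgcongr _ _ _ _ (hcc s), rfl⟩
    · have h' : (ComplexEmbedding.conjugate s).comp i = τ := hconj_over s h
      rw [htoF_neg s h, htoF_pos _ h']
      rfl
  · -- the type
    rw [he]
    by_cases h : s.comp i = τ
    · rw [htoF_pos s h, huniq s h]
      change s = sP ↔ true = decide (g ⟨s, _⟩ = 0)
      constructor
      · rintro rfl
        rw [hgP, decide_eq_true rfl]
      · intro hb
        have h0 : g ⟨s, (hmemF s).2 h⟩ = g ⟨sP, hsPF⟩ := by rw [hgP]; exact of_decide_eq_true hb.symm
        exact congrArg Subtype.val (g.injective h0)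
    · have hc : (ComplexEmbedding.conjugate s).comp i = τ := hconj_over s h
      rw [htoF_neg s h, Φ.2 s, huniq _ hc]
      change ¬ ComplexEmbedding.conjugate s = sP ↔ false = decide (g ⟨ComplexEmbedding.conjugate s, _⟩ = 0)
      constructor
      · intro hne
        rw [eq_comm, decide_eq_false_iff_not]
        intro h0
        apply hne
        have h0' : g ⟨ComplexEmbedding.conjugate s, (hmemF _).2 hc⟩ = g ⟨sP, hsPF⟩ := by rw [hgP]; exact h0
        exact congrArg Subtype.val (g.injective h0')
      · intro hb heq
        have : (⟨ComplexEmbedding.conjugate s, (hmemF _).2 hc⟩ : {s // s ∈ F}) = ⟨sP, hsPF⟩ := Subtype.ext heq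
        rw [this, hgP, decide_eq_true rfl] at hb
        exact Bool.false_ne_true hb

end Frame

/-! ## §2 The intrinsic theorem for `⨁_j ![E, T, B] (κ j)` -/

section Vec

variable {k K₁ K₂ : Type} [Field k] [NumberField k] [IsCMField k] [Field K₁] [NumberField K₁] [IsCMField K₁]
  [Field K₂] [NumberField K₂] [IsCMField K₂] {N : ℕ}
  {E T B : AbelianVariety ℂ} {Ψ : CMType k} {Φ₁ : CMType K₁} {Φ₂ : CMType K₂}
  {ιE : 𝓞 k →+* End E} {θE : k →+* Module.End ℂ (complexBetti E.X 1)}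
  {ιT : 𝓞 K₁ →+* End T} {θT : K₁ →+* Module.End ℂ (complexBetti T.X 1)}
  {ιB : 𝓞 K₂ →+* End B} {θB : K₂ →+* Module.End ℂ (complexBetti B.X 1)}

/-- **MAIN THEOREM (intrinsic form).  The Hodge conjecture for every product of copies of `E`, `T`, `B` — `E^a × T^n × B^m`, all
exponents, any order (`⨁_j ![E, T, B] (κ j)`, `κ : Fin N → Fin 3`) — GIVEN ONLY Markman's fourfold and hyperbolic-sixfold theorems**,
where `k` is an imaginary quadratic field, `K₁ ⊇ i₁(k)` ANY sextic CM field, `K₂ ⊇ i₂(k)` ANY octic CM field, `E ⊨ (k; Ψ)` a CM elliptic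
curve (`τ ∈ Ψ`), `T ⊨ (K₁; Φ₁)` a CM abelian threefold whose type has exactly ONE member over `τ` (`k`-signature `(1,2)`), `B ⊨ (K₂; Φ₂)` a
CM abelian fourfold whose type has exactly ONE member over `τ` (`k`-signature `(1,3)`), under JOINT TRANSITIVITY `hJT`: any two pairs of
embeddings `(x, y)`, `(x', y')` of `(K₁, K₂)` over `τ` are related by ONE automorphism of `ℂ` (automatic for these degrees — the sequel
`CorCM/SexticOcticWeilJointTransitive.lean`).  The Hodge rings contain the Weil classes of the FOURFOLD `T × E`, the SIXFOLD `B × E × E`, the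
EIGHTFOLD `Ē × T × B̄` and the TENFOLD `T × T × B̄`; all are algebraic modulo the two facts.  `HC_CM` is NOT asserted.
[cite: Markman2025SurveySecant, Thm. 1.2] [cite: Markman2025SecantWeil, Thm 1.5.1] [cite: Pohlmann1968, Thm 1] -/
theorem hodgeConjectureFor_biproduct_comp_vec_of_markman
    (hW4 : Markman2025_weilClasses_algebraic_abelianFourfold) (hM6 : Markman2025_weilClasses_algebraic_hyperbolicSixfold)
    (h2 : Module.finrank ℚ k = 2) (h6 : Module.finrank ℚ K₁ = 6) (h8 : Module.finrank ℚ K₂ = 8) (i₁ : k →+* K₁) (i₂ : k →+* K₂)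
    (hE : IsCMTypeRealisation Ψ E ιE θE) (hT : IsCMTypeRealisation Φ₁ T ιT θT) (hB : IsCMTypeRealisation Φ₂ B ιB θB)
    {τ : k →+* ℂ} (hτΨ : τ ∈ Ψ.1)
    (h12 : (Finset.univ.filter fun s : K₁ →+* ℂ => s.comp i₁ = τ ∧ s ∈ Φ₁.1).card = 1)
    (h13 : (Finset.univ.filter fun t : K₂ →+* ℂ => t.comp i₂ = τ ∧ t ∈ Φ₂.1).card = 1)
    (hJT : ∀ (x x' : K₁ →+* ℂ) (y y' : K₂ →+* ℂ), x.comp i₁ = τ → x'.comp i₁ = τ → y.comp i₂ = τ → y'.comp i₂ = τ →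
      ∃ ρ : ℂ ≃+* ℂ, (ρ : ℂ →+* ℂ).comp x = x' ∧ (ρ : ℂ →+* ℂ).comp y = y')
    (κ : Fin N → Fin 3) :
    HodgeConjectureFor (⨁ fun j => (![E, T, B] : Fin 3 → AbelianVariety ℂ) (κ j)).dim
      (⨁ fun j => (![E, T, B] : Fin 3 → AbelianVariety ℂ) (κ j)).X := by
  have hττ : ComplexEmbedding.conjugate τ ≠ τ := QuarticCM.conjugate_ne τ
  have hk : ∀ σ : k →+* ℂ, σ = τ ∨ σ = ComplexEmbedding.conjugate τ := fun σ => QuarticCM.eq_or_eq_conjugate_of_quadratic h2 τ σ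
  have hΨ : ∀ σ : k →+* ℂ, σ ∈ Ψ.1 ↔ σ = τ := by
    intro σ
    rcases hk σ with rfl | rfl
    · exact ⟨fun _ => rfl, fun _ => hτΨ⟩
    · exact ⟨fun h => absurd h ((Ψ.2 τ).1 hτΨ), fun h => absurd h hττ⟩
  obtain ⟨δ₀, d, hd, hδ₀⟩ := CyclicSextic.exists_sq_eq_neg_nat_of_isTotallyComplex k h2
  obtain ⟨δ, hδ, hτ⟩ := OcticCurveFourfold.exists_delta_of_mem h2 hd hδ₀ τ
  -- the two frames
  obtain ⟨e₁, he₁_sign, he₁_conj, hΦ₁⟩ := exists_frame_fin (n := 2) i₁ hττ hk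
    (card_filter_comp_eq_of_finrank (n := 3) i₁ h6 h2 τ) Φ₁ h12
  obtain ⟨e₂, he₂_sign, he₂_conj, hΦ₂⟩ := exists_frame_fin (n := 3) i₂ hττ hk
    (card_filter_comp_eq_of_finrank (n := 4) i₂ h8 h2 τ) Φ₂ h13
  -- joint transitivity read in the frames
  have hjt : ∀ (x : Fin 3) (y : Fin 4), ∃ ρ : ℂ ≃+* ℂ,
      (ρ : ℂ →+* ℂ).comp (e₁.symm (x, true)) = e₁.symm (0, true) ∧ (ρ : ℂ →+* ℂ).comp (e₂.symm (y, true)) = e₂.symm (0, true) :=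
    fun x y => hJT _ _ _ _ ((he₁_sign _).1 (by rw [Equiv.apply_symm_apply])) ((he₁_sign _).1 (by rw [Equiv.apply_symm_apply]))
      ((he₂_sign _).1 (by rw [Equiv.apply_symm_apply])) ((he₂_sign _).1 (by rw [Equiv.apply_symm_apply]))
  -- the family of fields `(k, K₁, K₂)` with its instances (all identifications below are definitional)
  let Kf : Fin 3 → Type := Fin.cons k (Fin.cons K₁ (Fin.cons K₂ finZeroElim))
  letI instF : ∀ j, Field (Kf j) := Fin.cons ‹Field k› (Fin.cons ‹Field K₁› (Fin.cons ‹Field K₂› finZeroElim))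
  letI instN : ∀ j, NumberField (Kf j) :=
    Fin.cons ‹NumberField k› (Fin.cons ‹NumberField K₁› (Fin.cons ‹NumberField K₂› finZeroElim))
  haveI instC : ∀ j, IsCMField (Kf j) := Fin.cons ‹IsCMField k› (Fin.cons ‹IsCMField K₁› (Fin.cons ‹IsCMField K₂› finZeroElim))
  -- the data over the three slots `soSlots 0 1 2 = (0, 1, 2)`
  let Φ₃ : ∀ j : Fin 3, CMType (Kf (soSlots (0 : Fin 3) 1 2 j)) := Fin.cons Ψ (Fin.cons Φ₁ (Fin.cons Φ₂ finZeroElim))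
  let ι₃ : ∀ j : Fin 3, 𝓞 (Kf (soSlots (0 : Fin 3) 1 2 j)) →+* End ((![E, T, B] : Fin 3 → AbelianVariety ℂ) j) :=
    Fin.cons ιE (Fin.cons ιT (Fin.cons ιB finZeroElim))
  let θ₃ : ∀ j : Fin 3, Kf (soSlots (0 : Fin 3) 1 2 j) →+*
      Module.End ℂ (complexBetti ((![E, T, B] : Fin 3 → AbelianVariety ℂ) j).X 1) :=
    Fin.cons θE (Fin.cons θT (Fin.cons θB finZeroElim))
  have hA : ∀ j, IsCMTypeRealisation (Φ₃ j) ((![E, T, B] : Fin 3 → AbelianVariety ℂ) j) (ι₃ j) (θ₃ j) :=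
    Fin.cons hE (Fin.cons hT (Fin.cons hB finZeroElim))
  exact hodgeConjectureFor_biproduct_comp_of_frames_of_markman (Kf := Kf) (i₀ := (0 : Fin 3)) (i₁ := 1) (i₂ := 2)
    (A := (![E, T, B] : Fin 3 → AbelianVariety ℂ)) (Φ := Φ₃) (ι := ι₃) (θ := θ₃)
    hW4 hM6 κ h6 h8 h2 i₁ i₂ hd hδ hτ hA e₁ e₂ he₁_sign he₂_sign he₁_conj he₂_conj hΨ hΦ₁ hΦ₂ hjt

/-- **The Hodge conjecture for every abelian variety dominated by a product of copies of `E`, `T`, `B`** (intrinsic form): abelian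
subvarieties, quotients and isogeny images of the `E^a × T^n × B^m`, modulo Markman's two theorems and joint transitivity.
[cite: Markman2025SurveySecant, Thm. 1.2] [cite: Markman2025SecantWeil, Thm 1.5.1] [cite: MumfordAV1970, §19] -/
theorem hodgeConjectureFor_of_avDominatedBy_comp_vec_of_markman
    (hW4 : Markman2025_weilClasses_algebraic_abelianFourfold) (hM6 : Markman2025_weilClasses_algebraic_hyperbolicSixfold)
    (h2 : Module.finrank ℚ k = 2) (h6 : Module.finrank ℚ K₁ = 6) (h8 : Module.finrank ℚ K₂ = 8) (i₁ : k →+* K₁) (i₂ : k →+* K₂)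
    (hE : IsCMTypeRealisation Ψ E ιE θE) (hT : IsCMTypeRealisation Φ₁ T ιT θT) (hB : IsCMTypeRealisation Φ₂ B ιB θB)
    {τ : k →+* ℂ} (hτΨ : τ ∈ Ψ.1)
    (h12 : (Finset.univ.filter fun s : K₁ →+* ℂ => s.comp i₁ = τ ∧ s ∈ Φ₁.1).card = 1)
    (h13 : (Finset.univ.filter fun t : K₂ →+* ℂ => t.comp i₂ = τ ∧ t ∈ Φ₂.1).card = 1)
    (hJT : ∀ (x x' : K₁ →+* ℂ) (y y' : K₂ →+* ℂ), x.comp i₁ = τ → x'.comp i₁ = τ → y.comp i₂ = τ → y'.comp i₂ = τ →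
      ∃ ρ : ℂ ≃+* ℂ, (ρ : ℂ →+* ℂ).comp x = x' ∧ (ρ : ℂ →+* ℂ).comp y = y')
    (κ : Fin N → Fin 3) {X : AbelianVariety ℂ}
    (hX : Domination.AVDominatedBy X (⨁ fun j => (![E, T, B] : Fin 3 → AbelianVariety ℂ) (κ j))) :
    HodgeConjectureFor X.dim X.X :=
  Domination.hodgeConjectureFor_of_avDominatedBy
    (hodgeConjectureFor_biproduct_comp_vec_of_markman hW4 hM6 h2 h6 h8 i₁ i₂ hE hT hB hτΨ h12 h13 hJT κ) hX

end Vec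

end Summit.HodgeConjecture.CorCM.SexticOcticWeil

end
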